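import Literature.Claims.NS.Purvance2008
import HarnessLib

/-!
# C40 `Purvance2008` — kernel facts for the NS-claims sweep (D-0090), refuter-8

Typed record: `Literature.Claims.NS.Purvance2008` (typist-12, p477246), D. T. Purvance, *On the convergence
of periodic Navier–Stokes flows*, arXiv:math/0610086v14 (2008), §4.0 display (29) p.8 and §5.0 p.9.

Kernel facts (sorry-free, standard axioms), each at the abstract matrix / series grain the print argues at
(«Since coefficients d_{nr} are the same for all flows, they must be independent of the specifics of any
flow Π U_g which argues that (29) is true»):

* `not_Step_29` — fixed scalars summing to zero do NOT make `Σ_r d_{nr} X_{nr}` tend to zero for arbitrary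
  matrix families: already for `1 × 1` matrices, `d = (1, −1)`, `X = (1, 0)` gives the constant `1`.
* `not_Step_29_commutator` — the paper's own display (28) p.7, `u₃ − b₃ = ⅓(U₁U₀ − U₀U₁)u₀`: with the
  non-commuting elementary `2 × 2` matrices `U₀ = E₁₂`, `U₁ = E₂₁` the combination `⅓(U₁U₀ − U₀U₁)` is the
  constant `diag(−⅓, ⅓) ≠ 0`.
* `not_Step_29Factor` — the displayed factorisation `Σ_r d_r X_r = (Σ_r d_r)(Σ_r X_r)` is false (same scalar
  witness: `1 ≠ 0`).
* `not_Step_conv` — termwise `S_n − B_n → 0` plus convergence of `Σ B_n tⁿ` does not give convergence of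
  `Σ S_n tⁿ`: `B = 0`, `S_n = (n+1)⁻¹ · 1`, `t = 1` (harmonic series).

WHAT THIS IS NOT: not a claim about NS regularity or blow-up; not a claim about any author beyond the
typed locator.
-/

set_option linter.dupNamespace false

noncomputable section

open Filter Finset
open scoped Topology

namespace Summit.NavierStokesRegularity.NavierStokesRegularity.Theorems.Purvance2008

/-! ## (29) p.8 -/

/-- **Display (29) p.8 is false at the typed grain (C40).** `m = 1`, two terms, fixed scalars
`d = (1, −1)` (so `Σ_r d_r = 0`, the hypothesis (27)), matrices `X = (1, 0)`: the combination is the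
constant matrix `1`, whose `(0,0)` entry does not tend to `0`. Refutes
`Literature.Claims.NS.Purvance2008.Step_29` [refuted-substantive at the grain of the printed reason:
flow-independence of the scalars `d_{nr}` says nothing about `Σ_r d_{nr} Π U_g` for non-commuting
products — (28) p.7 itself exhibits `u₃ − b₃ = ⅓[U₁,U₀]u₀`]. [folklore] -/
theorem not_Step_29 : ¬ Literature.Claims.NS.Purvance2008.Step_29 := by
  intro h
  have key := h 1 (fun _ => 2) (fun _ r => if r = 0 then 1 else -1)
    (fun _ r => if r = 0 then 1 else 0) (by intro n; simp [Finset.sum_range_succ]) 0 0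
  have hconst : (fun n : ℕ => (∑ r ∈ range ((fun _ : ℕ => 2) n),
      (fun (_ : ℕ) (r : ℕ) => if r = 0 then (1 : ℂ) else -1) n r •
        (fun (_ : ℕ) (r : ℕ) => if r = 0 then (1 : Matrix (Fin 1) (Fin 1) ℂ) else 0) n r) 0 0) =
      fun _ => (1 : ℂ) := by
    funext n
    simp
  rw [hconst] at key
  exact one_ne_zero (tendsto_nhds_unique tendsto_const_nhds key)

/-- The elementary matrix `E₁₂`. -/
def U0 : Matrix (Fin 2) (Fin 2) ℂ := !![0, 1; 0, 0]

/-- The elementary matrix `E₂₁`. -/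
def U1 : Matrix (Fin 2) (Fin 2) ℂ := !![0, 0; 1, 0]

/-- `⅓(U₁U₀ − U₀U₁)` has `(0,0)` entry `−⅓`. [folklore] -/
theorem commutator_entry :
    (((1 : ℂ) / 3) • (U1 * U0) + (-(1 : ℂ) / 3) • (U0 * U1)) 0 0 = -(1 : ℂ) / 3 := by
  simp [U0, U1]

/-- **(29) against (28) (C40).** With the non-commuting elementary matrices `U₀ = E₁₂`, `U₁ = E₂₁`, the
order-3 difference displayed in (28) p.7, `S₃ − B₃ = ⅓ U₁U₀ − ⅓ U₀U₁` (scalars `⅓, −⅓` summing to zero),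
is the constant nonzero matrix `diag(−⅓, ⅓)`; feeding this fixed two-term family to (29) at every order
`n` gives a sequence that does not tend to zero. [folklore] -/
theorem not_Step_29_commutator : ¬ Literature.Claims.NS.Purvance2008.Step_29 := by
  intro h
  have key := h 2 (fun _ => 2) (fun _ r => if r = 0 then (1 : ℂ) / 3 else -(1 : ℂ) / 3)
    (fun _ r => if r = 0 then U1 * U0 else U0 * U1)
    (by intro n; simp [Finset.sum_range_succ]; ring) 0 0
  have hconst : (fun n : ℕ => (∑ r ∈ range ((fun _ : ℕ => 2) n),
      (fun (_ : ℕ) (r : ℕ) => if r = 0 then (1 : ℂ) / 3 else -(1 : ℂ) / 3) n r •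
        (fun (_ : ℕ) (r : ℕ) => if r = 0 then U1 * U0 else U0 * U1) n r) 0 0) =
      fun _ => -(1 : ℂ) / 3 := by
    funext n
    simp only [Finset.sum_range_succ, Finset.range_zero, Finset.sum_empty, zero_add,
      if_neg one_ne_zero]
    exact commutator_entry
  rw [hconst] at key
  have := tendsto_nhds_unique tendsto_const_nhds key
  norm_num at this

/-- **The displayed factorisation in (29) p.8 is false (C40).** `m = 1`, `k = 2`, `d = (1, −1)`,
`X = (1, 0)`: `Σ d_r X_r = 1` while `(Σ d_r)(Σ X_r) = 0 · 1 = 0`. Refutes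
`Literature.Claims.NS.Purvance2008.Step_29Factor` [refuted-substantive]. [folklore] -/
theorem not_Step_29Factor : ¬ Literature.Claims.NS.Purvance2008.Step_29Factor := by
  intro h
  have key := h 1 2 (fun r => if r = 0 then 1 else -1) (fun r => if r = 0 then 1 else 0)
  have e := congrFun (congrFun key 0) 0
  simp [Finset.sum_range_succ] at e

/-! ## §5.0 p.9 -/

/-- The comparison-free sequence `S_n = (n+1)⁻¹ · 1` (as real parts cast to `ℂ`). -/
def harmS (n : ℕ) : Matrix (Fin 1) (Fin 1) ℂ := ((((n + 1 : ℕ) : ℝ)⁻¹ : ℝ) : ℂ) • 1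

/-- Entries of `harmS n`: all equal to `(n+1)⁻¹`. [folklore] -/
theorem harmS_apply (n : ℕ) (i j : Fin 1) : harmS n i j = ((((n + 1 : ℕ) : ℝ)⁻¹ : ℝ) : ℂ) := by
  simp [harmS, Matrix.smul_apply, Subsingleton.elim i j]

/-- **The §5.0 transfer p.9 is false at the typed grain (C40).** `m = 1`, `B = 0`, `S_n = (n+1)⁻¹ · 1`:
`S_n − B_n → 0` entrywise and `Σ tⁿ B_n` converges trivially, but at `t = 1` the entry series
`Σ (n+1)⁻¹` diverges. Refutes `Literature.Claims.NS.Purvance2008.Step_conv` [refuted-substantive: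
termwise convergence of `S_n − B_n` to zero transfers no summability]. [folklore] -/
theorem not_Step_conv : ¬ Literature.Claims.NS.Purvance2008.Step_conv := by
  intro h
  have hlim : ∀ i j : Fin 1, Tendsto (fun n => (harmS n - 0) i j) atTop (𝓝 0) := by
    intro i j
    have hr : Tendsto (fun n : ℕ => (((n + 1 : ℕ) : ℝ))⁻¹) atTop (𝓝 0) :=
      tendsto_inv_atTop_zero.comp (tendsto_natCast_atTop_atTop.comp (tendsto_add_atTop_nat 1))
    have hc := ((Complex.continuous_ofReal.tendsto 0).comp hr)
    rw [Complex.ofReal_zero] at hc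
    refine hc.congr' (Eventually.of_forall fun n => ?_)
    simp [harmS_apply]
  have hB : ∀ t : ℝ, ∀ i j : Fin 1,
      Summable (fun n => (((t : ℂ)) ^ n • (0 : ℕ → Matrix (Fin 1) (Fin 1) ℂ) n) i j) := by
    intro t i j
    simp only [Pi.zero_apply, smul_zero, Matrix.zero_apply]
    exact summable_zero
  have key := h 1 harmS 0 hlim hB 1 0 0
  have e : (fun n => (((1 : ℝ) : ℂ) ^ n • harmS n) 0 0) = fun n => ((((n + 1 : ℕ) : ℝ)⁻¹ : ℝ) : ℂ) := by
    funext n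
    simp [harmS_apply]
  rw [e, Complex.summable_ofReal] at key
  have key' : Summable (fun n : ℕ => ((n : ℝ))⁻¹) :=
    (summable_nat_add_iff 1).mp (by simpa using key)
  exact Real.not_summable_natCast_inv key'

/-- **The continuum passage (Step 6) holds vacuously (C40)**: its first antecedent `Step_29` is false, so
the printed implication `Step_29 → Step_conv → ClaimedTheorem` is provable and says nothing. [folklore] -/
theorem step_continuum_holds : Literature.Claims.NS.Purvance2008.Step_continuum :=
  fun h29 _ => absurd h29 not_Step_29

end Summit.NavierStokesRegularity.NavierStokesRegularity.Theorems.Purvance2008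

end
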